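import Summits.CriticalPhenomena.SAWScalingLimit.Theorems.SAWLeftRightFKGLeftRightFKGInterlacedOfGraphTP2
import Summits.CriticalPhenomena.SAWScalingLimit.Theorems.SAWLeftRightFKGLeftRightFKGStubThreePointOfInterlaced
import Summits.CriticalPhenomena.SAWScalingLimit.Theorems.SAWLeftRightFKGLeftRightFKGOfInterlacedTP2
import Literature.Probability.RandomPlanarGeometry.SAWBridgeRadius
import HarnessLib

/-!
# `ThreePointAt x`: the three-point splitting inequality, and the structure theorem
# `InterlacedTP2At x ↔ GraphTP2At x ∧ ThreePointAt x` (crux `LeftRightFKG`, stmt-CriticalPhenomena-11232)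

Line `corner-localisation`, lead c2 (prover-line-stmt-CriticalPhenomena-11232-c2-0, 2026-08-16), skeleton v7.
Vocabulary file (reviewed): it NAMES the statement that separates the open cores of the two rank-2 cruxes of the
routes SAWLeftRightFKG / SAWTotalPositivity and records the structure theorem assembled from the two landed
directions.

* `ThreePointAt x` — the PINNED THREE-POINT SPLITTING INEQUALITY of the fugacity-`x` self-avoiding path kernel
  `Z_H = BoundaryTP2.pathKernel H x`: for every subgraph `H ≤ ℤ²` with finitely many non-isolated vertices, every
  vertex `w` having a lattice neighbour `w'` isolated in `H`, and all `p, q` with `w, p, q` pairwise distinct,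
  `Z_H(w,p) · Z_H(w,q) ≤ Z_H(p,q)` ("pinning a boundary point costs": the pairs of self-avoiding paths `p → w`,
  `w → q` weigh at most the self-avoiding paths `p → q`). A predicate in the fugacity (no parameterless named
  fact); nothing is asserted about it. At `x = x_c` it is the line's registered open stub `stub_threePoint`
  (`threePointAt_criticalFugacity_iff`), a new statement not in print: numerically the ratio
  `Z(p,q)/(Z(w,p)Z(w,q))` at `x_c` is `1.08` across width-2 necks, `1.10–1.15` in the bulk next to a pinhole and
  along straight boundaries, exactly `1` at cut vertices and `→ 1⁺` only at their perturbations; like the TP₂ core it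
  fails at every `x > x_c` on large boxes.
* `interlacedTP2At_iff` — **for `0 < x`: `InterlacedTP2At x ↔ GraphTP2At x ∧ ThreePointAt x`**
  (`⇐`: `ThreePoint.interlacedTP2At_of_graphTP2At`, Menger for two paths + cut-vertex factorisation, p125636;
  `⇒`: `graphTP2At_of_interlacedTP2At` (sibling `Kernel`) and the one-pendant trick
  `ThreePointPendant.stub_threePointOfInterlaced`, p125871).
* `leftRightFKG_of_graphTP2At_of_threePointAt` — the crux from the sibling core `GraphTP2At x_c` (verbatim the
  registered open stub of crux `SAWTotalPositivity.BoundaryTP2`, stmt-CriticalPhenomena-7115) and `ThreePointAt x_c`,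
  through the landed transfer `CornerLoc.leftRightFKG_of_interlacedTP2At` (p124491).
* `stub_threePointVocabulary` — the registered sub-goal carried by this file (the structure theorem, by name).
-/

noncomputable section

open Literature.Probability.LatticeModels Literature.Probability.RandomPlanarGeometry
open scoped ENNReal

namespace Summit.CriticalPhenomena.SAWScalingLimit.Theorems.LeftRightFKG.ThreePoint

/-- **The three-point splitting inequality at fugacity `x`** (`ThreePointAt x`): for every subgraph `H ≤ ℤ²`
with finitely many non-isolated vertices, every vertex `w` with a lattice neighbour `w'` isolated in `H`, and
all `p, q` such that `w, p, q` are pairwise distinct,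
`Z_H(w,p) · Z_H(w,q) ≤ Z_H(p,q)` for the self-avoiding path kernel `Z_H = BoundaryTP2.pathKernel H x`.
A predicate in the fugacity; nothing is asserted (at `x_c` it is an open statement, the registered stub
`stub_threePoint` of line `corner-localisation` of crux `LeftRightFKG`). [folklore] -/
def ThreePointAt (x : ℝ) : Prop :=
  ∀ H : SimpleGraph (Site 2), H ≤ zdGraph 2 → H.support.Finite →
    ∀ w w' p q : Site 2, (zdGraph 2).Adj w w' → w' ∉ H.support → w ≠ p → w ≠ q → p ≠ q →
      BoundaryTP2.pathKernel H x w p * BoundaryTP2.pathKernel H x w q ≤ BoundaryTP2.pathKernel H x p q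

/-- `ThreePointAt x` unfolded (definitional). [folklore] -/
theorem threePointAt_iff (x : ℝ) : ThreePointAt x ↔
    ∀ H : SimpleGraph (Site 2), H ≤ zdGraph 2 → H.support.Finite →
      ∀ w w' p q : Site 2, (zdGraph 2).Adj w w' → w' ∉ H.support → w ≠ p → w ≠ q → p ≠ q →
        BoundaryTP2.pathKernel H x w p * BoundaryTP2.pathKernel H x w q ≤ BoundaryTP2.pathKernel H x p q :=
  Iff.rfl

/-- At `x_c`, `ThreePointAt` is verbatim the registered open stub `stub_threePoint` of skeleton v7 (definitional).
[folklore] -/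
theorem threePointAt_criticalFugacity_iff : ThreePointAt SAW.criticalFugacity ↔
    ∀ H : SimpleGraph (Site 2), H ≤ zdGraph 2 → H.support.Finite →
      ∀ w w' p q : Site 2, (zdGraph 2).Adj w w' → w' ∉ H.support → w ≠ p → w ≠ q → p ≠ q →
        BoundaryTP2.pathKernel H SAW.criticalFugacity w p * BoundaryTP2.pathKernel H SAW.criticalFugacity w q ≤
          BoundaryTP2.pathKernel H SAW.criticalFugacity p q :=
  Iff.rfl

/-- `InterlacedTP2At x → ThreePointAt x` for `0 < x` (the one-pendant trick, p125871). [folklore] -/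
theorem threePointAt_of_interlacedTP2At {x : ℝ} (hx : 0 < x) (h : BoundaryTP2.InterlacedTP2At x) :
    ThreePointAt x :=
  ThreePointPendant.stub_threePointOfInterlaced x hx h

/-- `GraphTP2At x → ThreePointAt x → InterlacedTP2At x` for `0 ≤ x` (Menger for two paths + cut-vertex
factorisation, p125636). [cite: Diestel2017, Thm. 3.3.1] -/
theorem interlacedTP2At_of_graphTP2At_of_threePointAt {x : ℝ} (hx : 0 ≤ x) (h₁ : BoundaryTP2.GraphTP2At x)
    (h₂ : ThreePointAt x) : BoundaryTP2.InterlacedTP2At x :=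
  interlacedTP2At_of_graphTP2At hx h₁ h₂

/-- **Structure theorem.** For `0 < x` the interlacing-only TP₂ of the self-avoiding path kernel is EXACTLY the
conjunction of the disjointly-realisable TP₂ (`GraphTP2At x`, the core of crux `SAWTotalPositivity.BoundaryTP2`) and
the three-point splitting inequality: `InterlacedTP2At x ↔ GraphTP2At x ∧ ThreePointAt x`. [cite: Diestel2017, Thm. 3.3.1] -/
theorem interlacedTP2At_iff {x : ℝ} (hx : 0 < x) :
    BoundaryTP2.InterlacedTP2At x ↔ BoundaryTP2.GraphTP2At x ∧ ThreePointAt x :=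
  ⟨fun h => ⟨BoundaryTP2.graphTP2At_of_interlacedTP2At h, threePointAt_of_interlacedTP2At hx h⟩,
    fun h => interlacedTP2At_of_graphTP2At_of_threePointAt hx.le h.1 h.2⟩

/-- **The crux from the sibling core and the three-point inequality**: `GraphTP2At x_c → ThreePointAt x_c →
LeftRightFKG` (through `InterlacedTP2At x_c` and the landed transfer `CornerLoc.leftRightFKG_of_interlacedTP2At`,
p124491). [folklore] -/
theorem leftRightFKG_of_graphTP2At_of_threePointAt (h₁ : BoundaryTP2.GraphTP2At SAW.criticalFugacity)
    (h₂ : ThreePointAt SAW.criticalFugacity) :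
    Summit.CriticalPhenomena.SAWScalingLimit.Theses.SAWLeftRightFKG.LeftRightFKG :=
  CornerLoc.leftRightFKG_of_interlacedTP2At
    (interlacedTP2At_of_graphTP2At_of_threePointAt SAW.criticalFugacity_pos.le h₁ h₂)

/-- Below and at `x_c`, every fugacity at which the interlacing-only core holds is one at which the three-point
inequality holds; in particular `(∀ 0 < x < x_c, InterlacedTP2At x) → ∀ 0 < x < x_c, ThreePointAt x`. [folklore] -/
theorem threePointAt_of_subcritical
    (h : ∀ x : ℝ, 0 < x → x < SAW.criticalFugacity → BoundaryTP2.InterlacedTP2At x) :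
    ∀ x : ℝ, 0 < x → x < SAW.criticalFugacity → ThreePointAt x :=
  fun x hx hxc => threePointAt_of_interlacedTP2At hx (h x hx hxc)

/-- REGISTERED SUB-GOAL `stub_threePointVocabulary` (recorded on the crux item so that this vocabulary file lands as
a `--supports` file): the structure theorem by name, for every `0 < x`. [cite: Diestel2017, Thm. 3.3.1] -/
theorem stub_threePointVocabulary : ∀ x : ℝ, 0 < x →
    (BoundaryTP2.InterlacedTP2At x ↔ BoundaryTP2.GraphTP2At x ∧ ThreePointAt x) :=
  fun _ hx => interlacedTP2At_iff hx

end Summit.CriticalPhenomena.SAWScalingLimit.Theorems.LeftRightFKG.ThreePoint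

end
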